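import Literature.Probability.Process.StoppedMartingale
import HarnessLib

/-!
# Stopping a progressively measurable process at an optional time

Topic `Probability/Process`; theorems only. For a raw (neither completed nor right-continuous)
filtration `𝓕` of `ℝ≥0` and an **optional** time `ρ` (`Literature.Probability.Process.IsOptionalTime`:
`{ρ < t} ∈ 𝓕 t`, i.e. a stopping time of `𝓕₊`, Le Gall (2016), Prop. 3.9 / Revuz–Yor (1999),
Ch. I, Def. (4.1) ff.) we record the measurability facts that Mathlib proves for genuine stopping
times (`MeasureTheory.isStronglyProgressive_min_stopping_time`,
`MeasureTheory.IsStronglyProgressive.stoppedProcess`) and that remain true for optional times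
BECAUSE THE RUNNING TIME IS INCLUDED: although `{ρ ≤ s}` need not belong to `𝓕 s`, it belongs to
`𝓕 t` for every `t > s` (`IsOptionalTime.measurableSet_le_of_lt`), and this is all that the
progressive measurability of the stopped clock `(i, ω) ↦ i ∧ ρ ω` on `[0, t] × Ω` requires
(`IsOptionalTime.isStronglyProgressive_min`). Consequently a progressively measurable process
stopped at an optional time is progressively measurable, in particular adapted
(`IsOptionalTime.isStronglyProgressive_stoppedProcess`, `…stronglyAdapted_stoppedProcess`).
Also: constants and countable suprema of optional times are optional.

These serve the stochastic calculus of processes with only almost surely continuous paths (for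
which hitting times are available only as optional times, `ratExceed`), e.g. the point flow of
SLE(κ, ρ) (`Literature/Probability/RandomPlanarGeometry/ImaginaryGeometry*.lean`).

## References

* J.-F. Le Gall, *Brownian Motion, Martingales, and Stochastic Calculus* (2016), Prop. 3.9, Thm 3.7.
* D. Revuz, M. Yor, *Continuous Martingales and Brownian Motion* (3rd ed., 1999), Ch. I, §4,
  Def. (4.1)–Prop. (4.8).
-/

noncomputable section

open MeasureTheory Filter Set
open scoped NNReal Topology

namespace Literature.Probability.Process

variable {Ω : Type*} {m : MeasurableSpace Ω} {𝓕 : Filtration ℝ≥0 m} {ρ : Ω → WithTop ℝ≥0}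

/-- A constant random time is optional. [folklore] -/
theorem isOptionalTime_const (𝓕 : Filtration ℝ≥0 m) (c : WithTop ℝ≥0) :
    IsOptionalTime 𝓕 fun _ ↦ c := by
  intro t
  by_cases h : c < t
  · have : {ω : Ω | c < (t : WithTop ℝ≥0)} = univ := eq_univ_of_forall fun _ ↦ h
    rw [this]
    exact @MeasurableSet.univ Ω (𝓕 t)
  · have : {ω : Ω | c < (t : WithTop ℝ≥0)} = ∅ := eq_empty_of_forall_notMem fun _ hω ↦ h hω
    rw [this]
    exact @MeasurableSet.empty Ω (𝓕 t)

/-- The supremum of a sequence of optional times is optional: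
`{⨆ₖ ρₖ < t} = ⋃_{s ∈ ℚ, s < t} ⋂ₖ {ρₖ < s⁺}`. Le Gall (2016), Prop. 3.9 (stability of stopping times
of `𝓕₊`). [folklore] -/
theorem IsOptionalTime.iSup {σ : ℕ → Ω → WithTop ℝ≥0} (hσ : ∀ k, IsOptionalTime 𝓕 (σ k)) :
    IsOptionalTime 𝓕 fun ω ↦ ⨆ k, σ k ω := by
  intro t
  have hset : {ω | ⨆ k, σ k ω < (t : WithTop ℝ≥0)} =
      ⋃ q : ℚ, ⋃ (_ : ((q : ℝ).toNNReal : ℝ≥0) < t),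
        ⋂ k, {ω | σ k ω < (((q : ℝ).toNNReal : ℝ≥0) : WithTop ℝ≥0)} := by
    ext ω
    simp only [mem_setOf_eq, mem_iUnion, mem_iInter, exists_prop]
    constructor
    · intro h
      -- a rational strictly between the supremum and `t`
      have hne : (⨆ k, σ k ω) ≠ ⊤ := ne_top_of_lt h
      obtain ⟨r, hr⟩ := WithTop.ne_top_iff_exists.1 hne
      have hrt : r < t := by rw [← WithTop.coe_lt_coe, hr]; exact h
      obtain ⟨q, hq1, hq2⟩ := exists_rat_btwn (NNReal.coe_lt_coe.2 hrt)
      have hq0 : (0 : ℝ) ≤ q := r.coe_nonneg.trans hq1.le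
      refine ⟨q, ?_, fun k ↦ ?_⟩
      · rw [← NNReal.coe_lt_coe, Real.coe_toNNReal _ hq0]; exact hq2
      · refine lt_of_le_of_lt (le_iSup (fun k ↦ σ k ω) k) ?_
        rw [← hr, WithTop.coe_lt_coe, ← NNReal.coe_lt_coe, Real.coe_toNNReal _ hq0]
        exact hq1
    · rintro ⟨q, hqt, hq⟩
      refine lt_of_le_of_lt (iSup_le fun k ↦ (hq k).le) ?_
      exact WithTop.coe_lt_coe.2 hqt
  rw [hset]
  refine MeasurableSet.iUnion fun q ↦ MeasurableSet.iUnion fun hq ↦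
    MeasurableSet.iInter fun k ↦ ?_
  exact 𝓕.mono hq.le _ (hσ k _)

/-- For an optional time `ρ`, the event `{ρ ≤ s}` belongs to `𝓕 t` for every `t > s`
(`{ρ ≤ s} = ⋂ₙ {ρ < s + (t - s)/(n + 2)}`). Revuz–Yor (1999), Ch. I, §4 (stopping times of
`𝓕₊`). [folklore] -/
theorem IsOptionalTime.measurableSet_le_of_lt (hρ : IsOptionalTime 𝓕 ρ) {s t : ℝ≥0} (hst : s < t) :
    MeasurableSet[𝓕 t] {ω | ρ ω ≤ (s : WithTop ℝ≥0)} := by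
  have hd : 0 < t - s := tsub_pos_of_lt hst
  set d : ℕ → ℝ≥0 := fun n ↦ (t - s) / ((n : ℝ≥0) + 2) with hd_def
  have hdpos : ∀ n, 0 < d n := fun n ↦ div_pos hd (by positivity)
  have hdle : ∀ n, s + d n ≤ t := by
    intro n
    have h12 : (1 : ℝ≥0) ≤ (n : ℝ≥0) + 2 :=
      calc (1 : ℝ≥0) ≤ 2 := one_le_two
        _ ≤ (n : ℝ≥0) + 2 := le_add_of_nonneg_left bot_le
    have h1 : d n ≤ t - s := div_le_self (le_of_lt hd) h12
    calc s + d n ≤ s + (t - s) := by gcongr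
      _ = t := add_tsub_cancel_of_le hst.le
  have hset : {ω | ρ ω ≤ (s : WithTop ℝ≥0)} = ⋂ n : ℕ, {ω | ρ ω < ((s + d n : ℝ≥0) : WithTop ℝ≥0)} := by
    ext ω
    simp only [mem_setOf_eq, mem_iInter]
    constructor
    · intro h n
      exact lt_of_le_of_lt h (WithTop.coe_lt_coe.2 (lt_add_of_pos_right s (hdpos n)))
    · intro h
      have hne : ρ ω ≠ ⊤ := ne_top_of_lt (h 0)
      obtain ⟨r, hr⟩ := WithTop.ne_top_iff_exists.1 hne
      rw [← hr, WithTop.coe_le_coe]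
      have hr' : ∀ n, r < s + d n := fun n ↦ by
        have := h n
        rw [← hr, WithTop.coe_lt_coe] at this
        exact this
      by_contra hrs
      rw [not_le] at hrs
      -- choose `n` with `d n < r - s`
      have hgap : 0 < (r : ℝ) - s := sub_pos.2 (NNReal.coe_lt_coe.2 hrs)
      obtain ⟨n, hn⟩ := exists_nat_gt (((t : ℝ) - s) / ((r : ℝ) - s))
      have hn' : ((t : ℝ) - s) / ((n : ℝ) + 2) < (r : ℝ) - s := by
        rw [div_lt_iff₀ (by positivity)]
        rw [div_lt_iff₀ hgap] at hn
        nlinarith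
      have hdn : ((d n : ℝ≥0) : ℝ) = ((t : ℝ) - s) / ((n : ℝ) + 2) := by
        rw [hd_def]
        push_cast
        rw [NNReal.coe_sub hst.le]
      have := hr' n
      rw [← NNReal.coe_lt_coe, NNReal.coe_add, hdn] at this
      linarith
  rw [hset]
  exact MeasurableSet.iInter fun n ↦ 𝓕.mono (hdle n) _ (hρ _)

/-- **The clock stopped at an optional time is progressively measurable**: for an optional time
`ρ` of `𝓕`, `(i, ω) ↦ i ∧ ρ ω` (read in `ℝ≥0`) is strongly progressively measurable. On
`[0, t] × Ω` the sublevel set `{i ∧ ρ ω ≤ j}` is `{i ≤ j} ∪ [0, t] × {ρ ≤ j}` for `j < t` (and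
everything for `t ≤ j`), and `{ρ ≤ j} ∈ 𝓕 t` by `IsOptionalTime.measurableSet_le_of_lt`.
(Mathlib's `isStronglyProgressive_min_stopping_time` is the stopping-time case.)
Revuz–Yor (1999), Ch. I, Prop. (4.8); Le Gall (2016), Thm 3.7. [folklore] -/
theorem IsOptionalTime.isStronglyProgressive_min (hρ : IsOptionalTime 𝓕 ρ) :
    IsStronglyProgressive 𝓕 fun i ω ↦ (Min.min (i : WithTop ℝ≥0) (ρ ω)).untopA := by
  refine fun i ↦ (Measurable.untopA ?_).stronglyMeasurable
  let mprod : MeasurableSpace (Set.Iic i × Ω) := Subtype.instMeasurableSpace.prod (𝓕 i)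
  have hfst : Measurable[mprod] fun p : Set.Iic i × Ω ↦ ((p.1 : ℝ≥0) : WithTop ℝ≥0) :=
    ((@measurable_fst (Set.Iic i) Ω _ (𝓕 i)).subtype_val).withTop_coe
  have hsnd : @Measurable (Set.Iic i × Ω) Ω mprod (𝓕 i) fun p ↦ p.2 :=
    @measurable_snd (Set.Iic i) Ω _ (𝓕 i)
  refine measurable_of_Iic fun j ↦ ?_
  have hset : (fun p : Set.Iic i × Ω ↦ Min.min ((p.1 : ℝ≥0) : WithTop ℝ≥0) (ρ p.2)) ⁻¹' Set.Iic j =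
      {p | ((p.1 : ℝ≥0) : WithTop ℝ≥0) ≤ j} ∪ {p | ρ p.2 ≤ j} := by
    ext p
    simp only [mem_preimage, mem_Iic, min_le_iff, mem_union, mem_setOf_eq]
  rw [hset]
  have h1 : MeasurableSet[mprod] {p : Set.Iic i × Ω | ((p.1 : ℝ≥0) : WithTop ℝ≥0) ≤ j} :=
    hfst measurableSet_Iic
  induction j using WithTop.recTopCoe with
  | top =>
    have : {p : Set.Iic i × Ω | ρ p.2 ≤ ⊤} = univ :=
      eq_univ_of_forall fun p ↦ show ρ p.2 ≤ ⊤ from le_top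
    rw [this, union_univ]
    exact MeasurableSet.univ
  | coe j =>
    by_cases hji : j < i
    · refine h1.union ?_
      exact hsnd (hρ.measurableSet_le_of_lt hji)
    · -- `i ≤ j`: the first set is everything
      have : {p : Set.Iic i × Ω | ((p.1 : ℝ≥0) : WithTop ℝ≥0) ≤ (j : WithTop ℝ≥0)} = univ := by
        refine eq_univ_of_forall fun p ↦ ?_
        simp only [mem_setOf_eq, WithTop.coe_le_coe]
        exact p.1.2.trans (not_lt.1 hji)
      rw [this, univ_union]
      exact MeasurableSet.univ

/-- **A progressively measurable process stopped at an optional time is progressively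
measurable** (`u (i ∧ ρ ω) ω` is the composition of the jointly measurable `u` on `[0, t] × Ω` with
the progressively measurable stopped clock, which is `≤ i`). Mathlib's
`IsStronglyProgressive.stoppedProcess` is the stopping-time case.
Revuz–Yor (1999), Ch. I, Prop. (4.8). [folklore] -/
theorem IsOptionalTime.isStronglyProgressive_stoppedProcess {β : Type*} [TopologicalSpace β]
    {u : ℝ≥0 → Ω → β} (hu : IsStronglyProgressive 𝓕 u) (hρ : IsOptionalTime 𝓕 ρ) :
    IsStronglyProgressive 𝓕 (stoppedProcess u ρ) := by
  have h_meas := hρ.isStronglyProgressive_min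
  refine hu.comp h_meas fun i ω ↦ ?_
  show (Min.min (i : WithTop ℝ≥0) (ρ ω)).untopA ≤ i
  induction ρ ω using WithTop.recTopCoe with
  | top => rw [min_eq_left le_top]; exact le_of_eq rfl
  | coe t =>
    rw [← WithTop.coe_min, WithTop.untopA, WithTop.untopD_coe]
    exact min_le_left _ _

/-- A progressively measurable process stopped at an optional time is strongly adapted.
[folklore] -/
theorem IsOptionalTime.stronglyAdapted_stoppedProcess {β : Type*} [TopologicalSpace β]
    {u : ℝ≥0 → Ω → β} (hu : IsStronglyProgressive 𝓕 u) (hρ : IsOptionalTime 𝓕 ρ) :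
    StronglyAdapted 𝓕 (stoppedProcess u ρ) :=
  (hρ.isStronglyProgressive_stoppedProcess hu).stronglyAdapted

/-- The stopped clock `ω ↦ t ∧ ρ ω` of an optional time is `𝓕 t`-measurable. [folklore] -/
theorem IsOptionalTime.measurable_untopA_min (hρ : IsOptionalTime 𝓕 ρ) (t : ℝ≥0) :
    Measurable[𝓕 t] fun ω ↦ (Min.min (t : WithTop ℝ≥0) (ρ ω)).untopA :=
  (hρ.isStronglyProgressive_min.stronglyAdapted t).measurable

/-- The truncation event of an optional time at the running time is adapted:
`{ρ < t} ∈ 𝓕 t` (the defining property, as a named projection for use with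
`Literature.Analysis.FunctionSpaces.isStronglyProgressive_trunc`). [folklore] -/
theorem IsOptionalTime.measurableSet_lt (hρ : IsOptionalTime 𝓕 ρ) (t : ℝ≥0) :
    MeasurableSet[𝓕 t] {ω | ρ ω < t} :=
  hρ t

end Literature.Probability.Process
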